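import Literature.NumberTheory.EllipticCurves.InertiaInvariantsKodairaNeronMultiplicativeProofs
import Literature.NumberTheory.EllipticCurves.HasseWeilAbelianEulerFactorFrobenius
import Literature.NumberTheory.EllipticCurves.HasseWeilAbelianEulerFactorTorsionProofs
import Literature.NumberTheory.EllipticCurves.NodeReductionGaloisProofs
import Literature.NumberTheory.EllipticCurves.SplitNodeQuadraticProofs
import Literature.NumberTheory.EllipticCurves.LocalFrobeniusResidueProofs
import HarnessLib

/-!
# The Frobenius torsion facts at the multiplicative places, and the Euler factors of an elliptic
# curve, from the Kodaira–Néron finiteness alone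

Proof file (theorems only) closing the multiplicative part of the Euler-factor programme of
`HasseWeilAbelianEulerFactorElliptic` / `…Torsion` / `…TorsionProofs` / `…Frobenius`: the two
torsion-point forms of Serre–Tate's Lemma 2 for Frobenius elements,

* `WeierstrassCurve.serreTate_frobenius_smul_torsion_of_hasSplitMultiplicativeReductionAt W ℓ`
  (split: `σ(cP) = N v • (cP)`) and
* `WeierstrassCurve.serreTate_frobenius_smul_torsion_of_hasNonsplitMultiplicativeReductionAt W ℓ`
  (non-split: `σ(cP) = -(N v • (cP))`),

are **proved from the Kodaira–Néron finiteness alone** (the named fact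
`kodairaNeron_exists_finset_reducesToNonsingular` for the minimal models, Silverman *ATAEC*
Cor. IV.9.2(d), *AEC* Cor. VII.6.2 — proved in neither book), and consequently so is the
corrected Euler-factor fact:

* `WeierstrassCurve.hasseWeilEulerFactor_geomPoints_of_isElliptic_of_kodairaNeron`:
  **`(∀ v, Kodaira–Néron at v) → hasseWeilEulerFactor_geomPoints_of_isElliptic W ℓ`** — for an
  elliptic curve over a number field, `det(1 - σ_v T ∣ (V_ℓ E)_{I_v}) = L_v(E, T)` at every finite
  place `v ∤ ℓ` (Silverman, *AEC*, C.§16), with the good places from the tree's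
  `hasseWeilEulerFactor_of_hasGoodReduction_holds`, the two codimension facts (*ATAEC* IV.10.2(a))
  from `InertiaInvariantsKodairaNeron{Multiplicative,Additive}Proofs`, and the assembly
  `hasseWeilEulerFactor_geomPoints_of_isElliptic_of_codim_of_frobenius_torsion`.

## The proof of the torsion facts (Serre–Tate §1 Lemma 2 for elliptic curves, made explicit)

`smul_nsmul_torsion_of_hasMultiplicativeReductionAt_of_kodairaNeron_primeBelow` (at the prime
`𝔓_{ι,𝔐}` cut out by an embedding `ι : K̄ → K̄_v`; then `…_at` for every `𝔓 ∣ v` by transitivity).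
Inside `K̄_v` with its spectral valuation `w` (the rendering of
`InertiaInvariantsKodairaNeronMultiplicativeProofs`, whose reduction data we rebuild): the minimal
model `X`, its `𝒪_w`-model `W₀`, whose reduction is a node, *presented* as
`singularModel x₀ y₀ α₁ α₂` over the algebraically closed residue field `k(𝒪_w)`
(`SingularCubic`); the explicit reduction map `r = ψ ∘ reduction : E₀ → k(𝒪_w)ˣ` with kernel `E₁`
(`NodeReductionMapProofs`); the transport `E(K̄) → X(K̄_v) = W₀(K̄_v)` (`pointsMapOfEmb`, `Φ`),
`A' = E(K̄)^{I_𝔓} ∩ (transport)⁻¹(E₀)`, the exponent `c` from Kodaira–Néron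
(`exists_nsmul_hasNonsingularReduction_of_kodairaNeron`), `E₁[ℓ] = 0`.  New here: a local
Frobenius `σ_v ∈ Γ_{K_v}` (`exists_isArithFrobAt_localAbsIntegers`) restricts to an arithmetic
Frobenius `σ₀` at `𝔓_{ι,𝔐}` (`isArithFrobAt_resGalOfEmb`); it acts on `r` through the residue
endomorphism `σ̄_v`, equivariantly or anti-equivariantly according as `σ̄_v` fixes or swaps the
tangent slopes (`NodeReductionGaloisProofs`); `σ̄_v` is the `N v`-th power (`IsArithFrobAt`), its
fixed points are `k_v` (`LocalFrobeniusResidueProofs`), so by Mathlib's definition of split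
multiplicative reduction the slopes are fixed exactly in the split case
(`SplitNodeQuadraticProofs`); `A'` is `σ₀`-stable (`σ₀` normalises `I_𝔓`; `E₀` is `σ_v`-stable);
the residue map `φ : \bar ℤ_K/𝔓 → k(𝒪_w)` intertwines `σ₀` and `σ̄_v`; the datum-shape theorems
`smul_nsmul_eq_residueCard_smul_of_reduction`, `smul_nsmul_eq_neg_residueCard_smul_of_reduction`
(`HasseWeilAbelianEulerFactorTorsionProofs`) give the conclusion for `σ₀`, and
`IsArithFrobAt.mul_inv_mem_inertia` for every Frobenius at `𝔓` (inertia fixes `c • P`).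

## References

* J.-P. Serre, J. Tate, *Good reduction of abelian varieties*, Ann. of Math. (2) 88 (1968),
  §1 Lemma 1, Lemma 2 (p. 495), §2 Thm. 3. [SerreTate1968]
* J. H. Silverman, *The Arithmetic of Elliptic Curves*, 2nd ed. (2009): Exercise 3.5(a),
  Prop. III.2.5, VII.2.1, VII.3.1, VII.§5, Thm. VII.6.1, C.§16 (PDF pp. 59, 97, 167–177, 390).
  [SilvermanAEC2009]
* J. H. Silverman, *Advanced Topics in the Arithmetic of Elliptic Curves* (1994): Thm. IV.10.2(a)
  and its proof (PDF pp. 358–359), Cor. IV.9.2(d), Exercise 5.13. [SilvermanATAEC1994]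
* J. Neukirch, *Algebraic Number Theory* (1999), Ch. II §9. [NeukirchANT1999]

## Design

Theorems only; `open scoped Classical NNReal Pointwise`; one universe `u`;
`set_option maxHeartbeats 1600000` and `synthInstance.maxHeartbeats 200000` for the core proof
(long, many coercions, pointwise actions on ideals).  All axioms `propext`, `Classical.choice`,
`Quot.sound`.
-/

noncomputable section

open scoped Classical NNReal Pointwise
open NumberField IsDedekindDomain

universe u

namespace WeierstrassCurve

open Literature.NumberTheory.EllipticCurves Literature.NumberTheory.GaloisRepresentations Field
  IsDedekindDomain.HeightOneSpectrum

variable {K : Type u} [Field K] [NumberField K] {v : HeightOneSpectrum (𝓞 K)}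
  (W : WeierstrassCurve K) (ℓ : ℕ) [Fact ℓ.Prime]

set_option maxHeartbeats 1600000 in
set_option synthInstance.maxHeartbeats 200000 in
/-- **Serre–Tate's Lemma 2 at a multiplicative place, on torsion points, for Frobenius elements —
from Kodaira–Néron, at the prime cut out by an embedding.**  Let `E/K` be elliptic, `ℓ` a prime,
`v ∤ ℓ` a place of multiplicative reduction, `ι : K̄ → K̄_v` a `K`-embedding and `𝔐` the prime of
`\bar 𝓞_v` above `𝓂_v`, `𝔓 = 𝔓_{ι,𝔐}`.  Granted the Kodaira–Néron finiteness for the minimal model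
at `v`, there is `c ≠ 0` such that for every arithmetic Frobenius `σ ∈ Γ_K` at `𝔓`, every `n`
and every `I_𝔓`-fixed `P ∈ E(K̄)` with `ℓⁿ P = O`: **`σ(cP) = N v • (cP)` if the reduction is
split, `σ(cP) = -(N v • (cP))` if it is non-split.**  Proof: the reduction data of
`InertiaInvariantsKodairaNeronMultiplicativeProofs` (`A' = E₀ ∩ E(K̄)^{I_𝔓}` inside `K̄_v`, `c`
from Kodaira–Néron, kernel `E₁` without `ℓ`-torsion) with the *explicit* node map
`r = ψ ∘ reduction` (`NodeReductionMapProofs`), its Galois behaviour under the local Frobenius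
`σ_v` (`NodeReductionGaloisProofs`: `σ̄_v` fixes or swaps the tangent slopes, and `r` is
accordingly equivariant or anti-equivariant), the decision split ↔ slopes fixed by the
`N v`-power Frobenius of the residue field (`SplitNodeQuadraticProofs`,
`LocalFrobeniusResidueProofs`), fed into the datum-shape theorems of
`HasseWeilAbelianEulerFactorTorsionProofs`; from `σ₀ = σ_v|_{K̄}` (an arithmetic Frobenius at
`𝔓`, `isArithFrobAt_resGalOfEmb`) to every Frobenius at `𝔓` by `IsArithFrobAt.mul_inv_mem_inertia`
(inertia acts trivially on `I_𝔓`-fixed points).  Silverman, *AEC*, Exercise 3.5(a), VII.2.1,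
VII.3.1, VII.6.1; Serre–Tate §1 Lemmas 1–2.
[cite: SerreTate1968, §1 Lemma 1 and Lemma 2 (p. 495)]
[cite: SilvermanAEC2009, Exercise 3.5(a), Prop. VII.2.1, Thm. VII.6.1 (PDF pp. 97, 167, 177)] -/
theorem smul_nsmul_torsion_of_hasMultiplicativeReductionAt_of_kodairaNeron_primeBelow
    [W.IsElliptic]
    (hKN : (W.localMinimalModel v).kodairaNeron_exists_finset_reducesToNonsingular)
    (hℓ : (ℓ : 𝓞 K) ∉ v.asIdeal) (hmult : W.HasMultiplicativeReductionAt v)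
    (ι : AlgebraicClosure K →ₐ[K] AlgebraicClosure (v.adicCompletion K))
    {𝔐 : Ideal v.localAbsIntegers} (h𝔐 : 𝔐 ∈ v.localPrimesAbove) :
    ∃ c : ℕ, c ≠ 0 ∧ ∀ ⦃σ : absoluteGaloisGroup K⦄,
      IsArithFrobAt (𝓞 K) σ (v.primeBelow ι 𝔐) → ∀ (n : ℕ) (P : geomPoints W),
      (∀ τ ∈ (v.primeBelow ι 𝔐).inertia (absoluteGaloisGroup K), τ • P = P) → ℓ ^ n • P = 0 →
      (W.HasSplitMultiplicativeReductionAt v → σ • (c • P) = v.residueCard • (c • P)) ∧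
      (¬ W.HasSplitMultiplicativeReductionAt v → σ • (c • P) = -(v.residueCard • (c • P))) := by
  obtain ⟨w, hw⟩ := v.exists_spectralValuation
  have hv0 : w.Integers w.integer := Valuation.integer.integers w
  haveI := henselianRing_integer w
  haveI := isAlgClosed_residueField_integer w
  -- ### models: `X = W_min`, its integral model `I` over `𝓞_v`, the `𝒪_w`-model `W₀`
  haveI : (W.localMinimalModel v).IsElliptic := W.isElliptic_localMinimalModel v
  have hmult' : (W.localMinimalModel v).HasMultiplicativeReduction (v.adicCompletionIntegers K) :=
    hmult
  have hIX : ((W.localMinimalModel v).integralModel (v.adicCompletionIntegers K)).map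
      (algebraMap (v.adicCompletionIntegers K) (v.adicCompletion K)) = W.localMinimalModel v :=
    baseChange_integralModel_eq (v.adicCompletionIntegers K) (W.localMinimalModel v)
  have hint : ((W.localMinimalModel v).baseChange (AlgebraicClosure (v.adicCompletion K))).IsIntegral
      w.integer := by
    have := isIntegral_spectralValuation_baseChange hw
      ((W.localMinimalModel v).integralModel (v.adicCompletionIntegers K))
    rwa [hIX] at this
  haveI := hint
  obtain ⟨W₀, hW₀⟩ := hint.integral
  set I := (W.localMinimalModel v).integralModel (v.adicCompletionIntegers K) with hIdef
  -- `W₀` has the coefficients of `I`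
  have hW₀I : W₀.map (algebraMap w.integer (AlgebraicClosure (v.adicCompletion K))) =
      I.map ((algebraMap (v.adicCompletion K) (AlgebraicClosure (v.adicCompletion K))).comp
        (algebraMap (v.adicCompletionIntegers K) (v.adicCompletion K))) := by
    rw [← map_map, hIX]
    exact hW₀.symm
  have hle : ∀ a : v.adicCompletionIntegers K,
      w (algebraMap (v.adicCompletion K) (AlgebraicClosure (v.adicCompletion K))
        (algebraMap (v.adicCompletionIntegers K) (v.adicCompletion K) a)) ≤ 1 :=
    fun a ↦ (spectralValuation_algebraMap_le_one_iff hw _).mpr a.2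
  -- ### the reduction of `W₀` is a node; present it
  have hΔ : IsLocalRing.residue w.integer W₀.Δ = 0 := by
    have hlt := hmult'.badReduction
    rw [← integralModel_Δ_eq (v.adicCompletionIntegers K) (W.localMinimalModel v)] at hlt
    have hmem := (IsDedekindDomain.HeightOneSpectrum.valuation_lt_one_iff_mem _ _).mp hlt
    rw [← v_algebraMap_lt_one_iff hv0]
    have hΔeq : algebraMap w.integer (AlgebraicClosure (v.adicCompletion K)) W₀.Δ =
        algebraMap (v.adicCompletion K) (AlgebraicClosure (v.adicCompletion K))
          (algebraMap (v.adicCompletionIntegers K) (v.adicCompletion K) I.Δ) := by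
      rw [← map_Δ, hW₀I, map_Δ]; rfl
    rw [hΔeq]
    exact spectralValuation_algebraMap_lt_one_of_mem_maximalIdeal hw h𝔐 hmem
  have hc₄not : I.c₄ ∉ IsLocalRing.maximalIdeal (v.adicCompletionIntegers K) := fun hmem ↦ by
    have heq := hmult'.multiplicativeReduction
    rw [← integralModel_c₄_eq (v.adicCompletionIntegers K) (W.localMinimalModel v)] at heq
    have := (IsDedekindDomain.HeightOneSpectrum.valuation_lt_one_iff_mem
      (K := v.adicCompletion K)
      (IsDiscreteValuationRing.maximalIdeal (v.adicCompletionIntegers K)) _).mpr hmem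
    rw [heq] at this
    exact lt_irrefl _ this
  have hc₄O : IsLocalRing.residue (v.adicCompletionIntegers K) I.c₄ ≠ 0 := fun h0 ↦
    hc₄not ((IsLocalRing.residue_eq_zero_iff _).mp h0)
  have hc₄ : IsLocalRing.residue w.integer W₀.c₄ ≠ 0 := by
    have hunit : IsUnit I.c₄ := by
      by_contra hu
      exact hc₄not ((IsLocalRing.mem_maximalIdeal _).mpr hu)
    rw [← v_algebraMap_eq_one_iff hv0]
    have hc₄eq : algebraMap w.integer (AlgebraicClosure (v.adicCompletion K)) W₀.c₄ =
        algebraMap (v.adicCompletion K) (AlgebraicClosure (v.adicCompletion K))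
          (algebraMap (v.adicCompletionIntegers K) (v.adicCompletion K) I.c₄) := by
      rw [← map_c₄, hW₀I, map_c₄]; rfl
    rw [hc₄eq]
    exact spectralValuation_eq_one_of_isUnit hw hunit
  set V := W₀.map (IsLocalRing.residue w.integer) with hVdef
  have hVΔ : V.Δ = 0 := by rw [hVdef, map_Δ, hΔ]
  have hVc₄ : V.c₄ ≠ 0 := by rw [hVdef, map_c₄]; exact hc₄
  obtain ⟨x₀, y₀, hE, hX, hY⟩ := V.exists_singularPoint hVΔ
  obtain ⟨α₁, α₂, hs, hp⟩ := V.exists_tangentSlopes x₀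
  have hV : W₀.map (IsLocalRing.residue w.integer) = singularModel x₀ y₀ α₁ α₂ :=
    V.eq_singularModel hE hX hY hs hp
  have hα : α₁ ≠ α₂ := fun h ↦ hVc₄ (by
    change (W₀.map (IsLocalRing.residue w.integer)).c₄ = 0
    rw [hV, singularModel.c₄_eq, h, sub_self, zero_pow four_ne_zero])
  -- the explicit reduction map onto the torus
  obtain ⟨r, hr0, hrf⟩ := W₀.exists_addMonoidHom_units_of_map_eq_singularModel hv0 hV hα
  -- ### transport and the Kodaira–Néron exponent
  obtain ⟨C, hC⟩ := W.exists_variableChange_smul_eq_localMinimalModel v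
  obtain ⟨Φ, hΦ⟩ := W.exists_addEquiv_localPoints_of_smul_eq v hC
  obtain ⟨c, hc, hcE₀⟩ := exists_nsmul_hasNonsingularReduction_of_kodairaNeron hKN hw h𝔐 hW₀
  -- ### the local Frobenius and the residue maps
  obtain ⟨σv, hσv⟩ := exists_isArithFrobAt_localAbsIntegers v h𝔐
  set σvA : AlgebraicClosure (v.adicCompletion K) →ₐ[v.adicCompletion K]
      AlgebraicClosure (v.adicCompletion K) :=
    ((absoluteGaloisGroup.toAlgEquiv _ σv :
      AlgebraicClosure (v.adicCompletion K) ≃ₐ[v.adicCompletion K]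
        AlgebraicClosure (v.adicCompletion K)) :
      AlgebraicClosure (v.adicCompletion K) →ₐ[v.adicCompletion K]
        AlgebraicClosure (v.adicCompletion K)) with hσvA
  have hσvA_apply : ∀ z, σvA z = σv • z := fun _ ↦ rfl
  have hσ₁ : ∀ z, w (σvA z) = w z := fun z ↦ by rw [hσvA_apply]; exact spectralValuation_smul hw σv z
  obtain ⟨σk, hσres, hstable, hx₀k, hy₀k, hbranch⟩ :=
    W₀.exists_residueMap_nodeReduction_smul hW₀ σvA hσ₁ hV r hr0 hrf
  obtain ⟨j, hj, hjinj, hjfix⟩ := v.exists_residueFieldMap_adicCompletionIntegers hw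
  -- the Frobenius fixes the image of `k_v` …
  have hgj : ∀ t, σk (j t) = j t := by
    intro t
    obtain ⟨a, rfl⟩ := IsLocalRing.residue_surjective t
    have hσa : w (σvA (algebraMap (v.adicCompletion K) (AlgebraicClosure (v.adicCompletion K))
        (algebraMap (v.adicCompletionIntegers K) (v.adicCompletion K) a))) ≤ 1 := by
      rw [hσ₁]; exact hle a
    rw [hj a (hle a), hσres _ (hle a) hσa]
    congr 1
    apply Subtype.ext
    change σvA _ = _
    exact σvA.commutes _
  -- … and its fixed points come from `k_v`
  have hfix : ∀ u, σk u = u → u ∈ j.range := by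
    intro u hu
    obtain ⟨z, rfl⟩ := IsLocalRing.residue_surjective u
    have hσz : w (σv • (z : AlgebraicClosure (v.adicCompletion K))) ≤ 1 := by
      rw [← hσvA_apply, hσ₁]; exact z.2
    have h1 := hσres (z : AlgebraicClosure (v.adicCompletion K)) z.2 hσz
    have h2 := v.residue_smul_eq_pow_residueCard_of_isArithFrobAt hw h𝔐 hσv z hσz
    refine hjfix _ ?_
    have hz : (⟨(z : AlgebraicClosure (v.adicCompletion K)), z.2⟩ : w.integer) = z := Subtype.ext rfl
    rw [hz] at h1
    have h1' : σk (IsLocalRing.residue w.integer z) =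
        IsLocalRing.residue w.integer ⟨σv • (z : AlgebraicClosure (v.adicCompletion K)), hσz⟩ := h1
    rw [← h2, ← h1', hu]
  -- the reduced integral model, pushed into the residue field of `𝒪_w`, is the presented node
  have hIj : (I.map (IsLocalRing.residue (v.adicCompletionIntegers K))).map j =
      singularModel x₀ y₀ α₁ α₂ := by
    rw [← hV, map_map]
    have hcoef : ∀ (f : v.adicCompletionIntegers K) (g : w.integer),
        (g : AlgebraicClosure (v.adicCompletion K)) =
          algebraMap (v.adicCompletion K) (AlgebraicClosure (v.adicCompletion K))
            (algebraMap (v.adicCompletionIntegers K) (v.adicCompletion K) f) →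
        (j.comp (IsLocalRing.residue (v.adicCompletionIntegers K))) f =
          IsLocalRing.residue w.integer g := by
      intro f g hfg
      rw [RingHom.comp_apply, hj f (hle f)]
      exact congrArg _ (Subtype.ext hfg.symm)
    have e₁ := congrArg WeierstrassCurve.a₁ hW₀I
    have e₂ := congrArg WeierstrassCurve.a₂ hW₀I
    have e₃ := congrArg WeierstrassCurve.a₃ hW₀I
    have e₄ := congrArg WeierstrassCurve.a₄ hW₀I
    have e₆ := congrArg WeierstrassCurve.a₆ hW₀I
    simp only [map_a₁, map_a₂, map_a₃, map_a₄, map_a₆, RingHom.comp_apply] at e₁ e₂ e₃ e₄ e₆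
    ext
    · rw [map_a₁, map_a₁]; exact hcoef _ _ e₁
    · rw [map_a₂, map_a₂]; exact hcoef _ _ e₂
    · rw [map_a₃, map_a₃]; exact hcoef _ _ e₃
    · rw [map_a₄, map_a₄]; exact hcoef _ _ e₄
    · rw [map_a₆, map_a₆]; exact hcoef _ _ e₆
  -- ### which branch: split ↔ the Frobenius fixes the slopes
  have hsplit_fixed : W.HasSplitMultiplicativeReductionAt v → σk α₁ = α₁ ∧ σk α₂ = α₂ := by
    intro hs
    have hs' : (W.localMinimalModel v).HasSplitMultiplicativeReduction (v.adicCompletionIntegers K) :=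
      hs
    exact apply_slopes_eq_of_splits I j σk hIj hc₄O hgj hs'.splitMultiplicativeReduction
  have hfixed_split : σk α₁ = α₁ → σk α₂ = α₂ → W.HasSplitMultiplicativeReductionAt v := by
    intro h₁ h₂
    have hspl := splits_of_apply_slopes_eq I j σk hIj hc₄O hfix h₁ h₂
    show (W.localMinimalModel v).HasSplitMultiplicativeReduction (v.adicCompletionIntegers K)
    exact { toHasMultiplicativeReduction := hmult', splitMultiplicativeReduction := hspl }
  -- ### the reduction datum on `E(K̄)`
  set 𝔓 := v.primeBelow ι 𝔐 with h𝔓def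
  have h𝔓mem : 𝔓 ∈ v.primesAbove := primeBelow_mem_primesAbove h𝔐
  haveI : 𝔓.IsPrime := h𝔓mem.1
  set H := 𝔓.inertia (absoluteGaloisGroup K) with hH
  set σ₀ : absoluteGaloisGroup K := resGalOfEmb ι σv with hσ₀def
  have hσ₀ : IsArithFrobAt (𝓞 K) σ₀ 𝔓 := isArithFrobAt_resGalOfEmb h𝔐 ι hσv
  have hισ₀ : ∀ y : AlgebraicClosure K, ι (σ₀ • y) = σv • ι y := fun y ↦
    apply_resGalAuxOfEmb_apply ι σv y
  let G : geomPoints W →+ (W₀.baseChange (AlgebraicClosure (v.adicCompletion K))).toAffine.Point :=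
    (Affine.Point.congrEquiv hW₀).toAddMonoidHom.comp (Φ.toAddMonoidHom.comp (pointsMapOfEmb W ι))
  have hGapply : ∀ P : geomPoints W,
      G P = Affine.Point.congrEquiv hW₀ (Φ (pointsMapOfEmb W ι P)) := fun _ ↦ rfl
  have hGinj : Function.Injective G := fun P Q hPQ ↦ by
    rw [hGapply, hGapply] at hPQ
    exact pointsMapOfEmb_injective W ι (Φ.injective ((Affine.Point.congrEquiv hW₀).injective hPQ))
  have hGσ : ∀ P : geomPoints W, G (σ₀ • P) =
      Affine.Point.congrEquiv hW₀ (Affine.Point.map σvA (Φ (pointsMapOfEmb W ι P))) := by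
    intro P
    rw [hGapply, hσ₀def, pointsMapOfEmb_smul, hΦ σv]
  -- local inertia restricts into `I_𝔓`
  have hfixloc : ∀ P : geomPoints W, (∀ τ ∈ H, τ • P = P) →
      ∀ σ ∈ 𝔐.inertia (absoluteGaloisGroup (v.adicCompletion K)),
        Affine.Point.map ((absoluteGaloisGroup.toAlgEquiv _ σ :
            AlgebraicClosure (v.adicCompletion K) ≃ₐ[v.adicCompletion K]
              AlgebraicClosure (v.adicCompletion K)) :
            AlgebraicClosure (v.adicCompletion K) →ₐ[v.adicCompletion K]
              AlgebraicClosure (v.adicCompletion K)) (Φ (pointsMapOfEmb W ι P)) =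
          Φ (pointsMapOfEmb W ι P) := by
    intro P hP σ hσ
    rw [← hΦ σ, ← pointsMapOfEmb_smul]
    congr 2
    exact hP _ (resGalOfEmb_mem_inertia_primeBelow v ι 𝔐 hσ)
  let A' : AddSubgroup (geomPoints W) :=
    FixedPoints.addSubgroup H (geomPoints W) ⊓
      (W₀.nonsingularReductionSubgroup hv0).comap G
  have hA'mem : ∀ P : geomPoints W, P ∈ A' ↔
      (∀ τ ∈ H, τ • P = P) ∧ W₀.HasNonsingularReduction (G P) := by
    intro P
    rw [AddSubgroup.mem_inf, FixedPoints.mem_addSubgroup, AddSubgroup.mem_comap,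
      mem_nonsingularReductionSubgroup_iff]
    simp only [Subtype.forall, Subgroup.mk_smul]
  have hcA' : ∀ P : geomPoints W, (∀ τ ∈ H, τ • P = P) → c • P ∈ A' := by
    intro P hP
    rw [hA'mem]
    refine ⟨fun τ hτ ↦ by rw [smul_comm, hP τ hτ], ?_⟩
    rw [map_nsmul, hGapply, ← map_nsmul]
    exact hcE₀ _ (hfixloc P hP)
  -- `σ₀` normalises `I_𝔓`
  have hσ₀D : σ₀ • 𝔓 = 𝔓 := MulAction.mem_stabilizer_iff.mp hσ₀.mem_stabilizer
  have h𝔓inv : σ₀⁻¹ • 𝔓 = 𝔓 := by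
    conv_lhs => rw [← hσ₀D]
    rw [inv_smul_smul]
  have hconj : ∀ τ ∈ H, σ₀⁻¹ * τ * σ₀ ∈ H := by
    intro τ hτ x
    have h1 : τ • (σ₀ • x) - σ₀ • x ∈ 𝔓 := hτ (σ₀ • x)
    have h2 : σ₀⁻¹ • (τ • (σ₀ • x) - σ₀ • x) ∈ σ₀⁻¹ • 𝔓 :=
      Ideal.smul_mem_pointwise_smul_iff.mpr h1
    rw [h𝔓inv, smul_sub, inv_smul_smul, smul_smul, smul_smul] at h2
    exact h2
  have hA'σ : ∀ P : geomPoints W, P ∈ A' → σ₀ • P ∈ A' := by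
    intro P hP
    rw [hA'mem] at hP ⊢
    refine ⟨fun τ hτ ↦ ?_, ?_⟩
    · have := hP.1 _ (hconj τ hτ)
      calc τ • σ₀ • P = σ₀ • ((σ₀⁻¹ * τ * σ₀) • P) := by
            rw [mul_smul, mul_smul, smul_inv_smul]
        _ = σ₀ • P := by rw [this]
    · rw [hGσ]
      exact hstable _ (by rw [← hGapply]; exact hP.2)
  let r' : A' →+ Additive (IsLocalRing.ResidueField w.integer)ˣ :=
    r.comp ((G.comp A'.subtype).codRestrict (W₀.nonsingularReductionSubgroup hv0) (fun P ↦ P.2.2))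
  have hr'apply : ∀ P : A', r' P = r ⟨G P, P.2.2⟩ := fun _ ↦ rfl
  -- the kernel of `r'` has no `ℓ`-torsion (`E₁[ℓ] = 0`)
  have hℓw : w ((ℓ : ℤ) : AlgebraicClosure (v.adicCompletion K)) = 1 :=
    spectralValuation_intCast_eq_one hw (n := (ℓ : ℤ)) (by simpa using hℓ)
  have htf : ∀ P : A', r' P = 0 → ℓ • P = 0 → P = 0 := by
    intro P hrP hℓP
    have h0 : W₀.ReducesToZero (G P) := (hr0 ⟨G P, P.2.2⟩).mp hrP
    have hℓG : (ℓ : ℤ) • G P = 0 := by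
      rw [natCast_zsmul, ← map_nsmul, ← AddSubgroup.coe_nsmul, hℓP, AddSubgroup.coe_zero, map_zero]
    have hG0 : G P = 0 := h0.eq_zero_of_zsmul_eq_zero W₀ hℓw hℓG
    have hP0 : (P : geomPoints W) = 0 := hGinj (by rw [hG0, map_zero])
    exact Subtype.ext hP0
  -- the residue map of `\bar ℤ_K` at `𝔓` and its Frobenius compatibility
  obtain ⟨φ, hφinj, hφ⟩ := v.exists_ringHom_quotient_primeBelow hw ι h𝔐
  have hleK : ∀ b : absIntegers (𝓞 K) K, w (ι b) ≤ 1 := fun b ↦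
    (mem_localAbsIntegers_iff_spectralValuation hw).mp (absIntegersToLocal v ι b).2
  have hφσ : ∀ x : absIntegers (𝓞 K) K,
      φ (Ideal.Quotient.mk 𝔓 (σ₀ • x)) = σk (φ (Ideal.Quotient.mk 𝔓 x)) := by
    intro x
    have hσx : w (σvA (ι x)) ≤ 1 := by rw [hσ₁]; exact hleK x
    rw [hφ x (hleK x), hφ (σ₀ • x) (hleK _), hσres (ι x) (hleK x) hσx]
    congr 1
    apply Subtype.ext
    change ι ((σ₀ • x : absIntegers (𝓞 K) K) : AlgebraicClosure K) = σvA (ι x)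
    rw [integralClosure.coe_smul, hισ₀, hσvA_apply]
  -- values of `r'` on `σ₀`-moved points
  have hr'σ : ∀ (P : A') (hσmem : W₀.HasNonsingularReduction
      (Affine.Point.congrEquiv hW₀ (Affine.Point.map σvA (Φ (pointsMapOfEmb W ι P))))),
      r' ⟨σ₀ • (P : geomPoints W), hA'σ P P.2⟩ = r ⟨_, hσmem⟩ := by
    intro P hσmem
    rw [hr'apply]
    exact congrArg r (Subtype.ext (hGσ P))
  have hPmem : ∀ P : A', W₀.HasNonsingularReduction
      (Affine.Point.congrEquiv hW₀ (Φ (pointsMapOfEmb W ι P))) := fun P ↦ P.2.2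
  have hσPmem : ∀ P : A', W₀.HasNonsingularReduction
      (Affine.Point.congrEquiv hW₀ (Affine.Point.map σvA (Φ (pointsMapOfEmb W ι P)))) :=
    fun P ↦ hstable _ (hPmem P)
  -- ### conclusion for `σ₀`, then for every Frobenius at `𝔓`
  have key : ∀ (n : ℕ) (P : geomPoints W), (∀ τ ∈ H, τ • P = P) → ℓ ^ n • P = 0 →
      (W.HasSplitMultiplicativeReductionAt v → σ₀ • (c • P) = v.residueCard • (c • P)) ∧
      (¬ W.HasSplitMultiplicativeReductionAt v → σ₀ • (c • P) = -(v.residueCard • (c • P))) := by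
    intro n P hP hPn
    constructor
    · intro hs
      obtain ⟨h₁, h₂⟩ := hsplit_fixed hs
      -- the equivariant branch
      have hequiv : ∀ (Q : ((W.localMinimalModel v).baseChange
            (AlgebraicClosure (v.adicCompletion K))).toAffine.Point)
          (hQ : W₀.HasNonsingularReduction (Affine.Point.congrEquiv hW₀ Q))
          (hσQ : W₀.HasNonsingularReduction (Affine.Point.congrEquiv hW₀ (Affine.Point.map σvA Q))),
          ((r ⟨_, hσQ⟩).toMul : IsLocalRing.ResidueField w.integer) =
            σk ((r ⟨_, hQ⟩).toMul : IsLocalRing.ResidueField w.integer) := by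
        rcases hbranch with ⟨-, -, hb⟩ | ⟨hb₁, -, -⟩
        · exact hb
        · exact (hα (h₁.symm.trans hb₁)).elim
      refine smul_nsmul_eq_residueCard_smul_of_reduction ℓ hℓ h𝔓mem φ hφinj hσ₀ A' hA'σ hcA' r'
        (fun Q x hx ↦ ?_) htf n P hP hPn
      rw [hr'σ Q (hσPmem Q), hequiv _ (hPmem Q) (hσPmem Q), hφσ, hx]
      rfl
    · intro hns
      -- the anti-equivariant branch
      have hanti : ∀ (Q : ((W.localMinimalModel v).baseChange
            (AlgebraicClosure (v.adicCompletion K))).toAffine.Point)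
          (hQ : W₀.HasNonsingularReduction (Affine.Point.congrEquiv hW₀ Q))
          (hσQ : W₀.HasNonsingularReduction (Affine.Point.congrEquiv hW₀ (Affine.Point.map σvA Q))),
          ((r ⟨_, hσQ⟩).toMul : IsLocalRing.ResidueField w.integer) =
            (σk ((r ⟨_, hQ⟩).toMul : IsLocalRing.ResidueField w.integer))⁻¹ := by
        rcases hbranch with ⟨hb₁, hb₂, -⟩ | ⟨-, -, hb⟩
        · exact (hns (hfixed_split hb₁ hb₂)).elim
        · exact hb
      refine smul_nsmul_eq_neg_residueCard_smul_of_reduction ℓ hℓ h𝔓mem φ hφinj hσ₀ A' hA'σ hcA'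
        r' (fun Q x hx ↦ ?_) htf n P hP hPn
      rw [hr'σ Q (hσPmem Q), hanti _ (hPmem Q) (hσPmem Q), hφσ, hx]
      exact inv_mul_cancel₀ ((map_ne_zero σk).mpr (Units.ne_zero (Additive.toMul (r' Q))))
  refine ⟨c, hc, fun σ hσ n P hP hPn ↦ ?_⟩
  -- `σ = τ σ₀` with `τ ∈ I_𝔓`, which fixes `c • P`
  have hτ : σ * σ₀⁻¹ ∈ H := hσ.mul_inv_mem_inertia hσ₀
  have hcP : ∀ τ ∈ H, τ • (c • P) = c • P := fun τ hτ ↦ by rw [smul_comm, hP τ hτ]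
  have hσeq : σ = (σ * σ₀⁻¹) * σ₀ := by rw [inv_mul_cancel_right]
  obtain ⟨k₁, k₂⟩ := key n P hP hPn
  constructor
  · intro hs
    rw [hσeq, mul_smul, k₁ hs, smul_comm, hcP _ hτ]
  · intro hns
    rw [hσeq, mul_smul, k₂ hns, smul_neg, smul_comm, hcP _ hτ]

/-- **The same at every prime `𝔓 ∣ v`** (every such prime is cut out by an embedding: `Γ_K` is
transitive on the primes above `v`, `exists_smul_eq_of_mem_primesAbove_holds`, and
`𝔓_{ι∘τ,𝔐} = τ⁻¹ • 𝔓_{ι,𝔐}`, `primeBelow_comp`).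
[cite: SerreTate1968, §1 Lemma 1 and Lemma 2 (p. 495)] -/
theorem smul_nsmul_torsion_of_hasMultiplicativeReductionAt_of_kodairaNeron_at [W.IsElliptic]
    (hKN : (W.localMinimalModel v).kodairaNeron_exists_finset_reducesToNonsingular)
    (hℓ : (ℓ : 𝓞 K) ∉ v.asIdeal) (hmult : W.HasMultiplicativeReductionAt v)
    {𝔓 : Ideal (absIntegers (𝓞 K) K)} (h𝔓 : 𝔓 ∈ v.primesAbove) :
    ∃ c : ℕ, c ≠ 0 ∧ ∀ ⦃σ : absoluteGaloisGroup K⦄,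
      IsArithFrobAt (𝓞 K) σ 𝔓 → ∀ (n : ℕ) (P : geomPoints W),
      (∀ τ ∈ 𝔓.inertia (absoluteGaloisGroup K), τ • P = P) → ℓ ^ n • P = 0 →
      (W.HasSplitMultiplicativeReductionAt v → σ • (c • P) = v.residueCard • (c • P)) ∧
      (¬ W.HasSplitMultiplicativeReductionAt v → σ • (c • P) = -(v.residueCard • (c • P))) := by
  obtain ⟨𝔐, h𝔐⟩ := v.localPrimesAbove_nonempty
  obtain ⟨g, hg⟩ := HeightOneSpectrum.exists_smul_eq_of_mem_primesAbove_holds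
    (HeightOneSpectrum.primeBelow_mem_primesAbove
      (ι := closureEmb (K := K) (v.adicCompletion K)) h𝔐) h𝔓
  have h1 : 𝔓 = v.primeBelow ((closureEmb (K := K) (v.adicCompletion K)).comp
      ((show AlgebraicClosure K ≃ₐ[K] AlgebraicClosure K from g⁻¹) :
        AlgebraicClosure K →ₐ[K] AlgebraicClosure K)) 𝔐 := by
    rw [HeightOneSpectrum.primeBelow_comp, ← hg]
    exact congrArg (· • _) (inv_inv g).symm
  rw [h1]
  exact W.smul_nsmul_torsion_of_hasMultiplicativeReductionAt_of_kodairaNeron_primeBelow ℓ hKN hℓ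
    hmult _ h𝔐

/-- **The Frobenius torsion fact at the split multiplicative places,
`serreTate_frobenius_smul_torsion_of_hasSplitMultiplicativeReductionAt W ℓ`
(`HasseWeilAbelianEulerFactorFrobenius`; Serre–Tate §1 Lemmas 1–2 + split torus), from the
Kodaira–Néron finiteness at every finite place** (`kodairaNeron_exists_finset_reducesToNonsingular`
for the minimal models; *ATAEC* Cor. IV.9.2(d), *AEC* Cor. VII.6.2, proved in neither book).
[cite: SerreTate1968, §1 Lemma 1 and Lemma 2 (p. 495)]
[cite: SilvermanAEC2009, Exercise 3.5(a)(i), Prop. VII.2.1, Thm. VII.6.1 (PDF pp. 97, 167, 177)] -/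
theorem serreTate_frobenius_smul_torsion_of_hasSplitMultiplicativeReductionAt_of_kodairaNeron
    (hKN : ∀ v : HeightOneSpectrum (𝓞 K),
      (W.localMinimalModel v).kodairaNeron_exists_finset_reducesToNonsingular) :
    W.serreTate_frobenius_smul_torsion_of_hasSplitMultiplicativeReductionAt ℓ := by
  intro _ v hℓ hv 𝔓 h𝔓
  obtain ⟨c, hc, h⟩ := W.smul_nsmul_torsion_of_hasMultiplicativeReductionAt_of_kodairaNeron_at ℓ
    (hKN v) hℓ hv.hasMultiplicativeReductionAt h𝔓
  exact ⟨c, hc, fun σ hσ n P hP hPn ↦ (h hσ n P hP hPn).1 hv⟩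

/-- **The Frobenius torsion fact at the non-split multiplicative places,
`serreTate_frobenius_smul_torsion_of_hasNonsplitMultiplicativeReductionAt W ℓ`
(`HasseWeilAbelianEulerFactorTorsion`; Serre–Tate §1 Lemmas 1–2 + non-split torus), from the
Kodaira–Néron finiteness at every finite place.**
[cite: SerreTate1968, §1 Lemma 1 and Lemma 2 (p. 495)]
[cite: SilvermanAEC2009, Exercise 3.5(a)(ii), Prop. VII.2.1, Thm. VII.6.1 (PDF pp. 97, 167, 177)] -/
theorem serreTate_frobenius_smul_torsion_of_hasNonsplitMultiplicativeReductionAt_of_kodairaNeron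
    (hKN : ∀ v : HeightOneSpectrum (𝓞 K),
      (W.localMinimalModel v).kodairaNeron_exists_finset_reducesToNonsingular) :
    W.serreTate_frobenius_smul_torsion_of_hasNonsplitMultiplicativeReductionAt ℓ := by
  intro _ v hℓ hv hns 𝔓 h𝔓
  obtain ⟨c, hc, h⟩ := W.smul_nsmul_torsion_of_hasMultiplicativeReductionAt_of_kodairaNeron_at ℓ
    (hKN v) hℓ hv h𝔓
  exact ⟨c, hc, fun σ hσ n P hP hPn ↦ (h hσ n P hP hPn).2 hns⟩

/-- **The Euler factors of an elliptic curve from its Tate module, from Kodaira–Néron alone.**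
For an elliptic curve `E/K` over a number field, the corrected Euler-factor fact
`hasseWeilEulerFactor_geomPoints_of_isElliptic W ℓ` (`HasseWeilAbelianEulerFactorElliptic`;
Silverman, *AEC*, C.§16: `det(1 - σ_v T ∣ (V_ℓ E)_{I_v}) = L_v(E, T)` at every `v ∤ ℓ`) follows
from the Kodaira–Néron finiteness `E(K_v^nr)/E₀(K_v^nr)` finite at every finite place (the
named fact `kodairaNeron_exists_finset_reducesToNonsingular`, *ATAEC* Cor. IV.9.2(d)): the two
bad-place cases of *ATAEC* Thm. IV.10.2(a) are the tree's
`codimFixed_inertia_rationalTate_eq_one_of_hasMultiplicativeReductionAt_of_kodairaNeron`,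
`codimFixed_inertia_rationalTate_eq_two_of_hasAdditiveReductionAt_of_kodairaNeron`
(`InertiaInvariantsKodairaNeron{Multiplicative,Additive}Proofs`), the two Frobenius torsion facts
are the theorems above, and `hasseWeilEulerFactor_geomPoints_of_isElliptic_of_codim_of_frobenius_torsion`
(`HasseWeilAbelianEulerFactorFrobenius`) assembles them with the good places
(`hasseWeilEulerFactor_of_hasGoodReduction_holds`).  So after this file the Euler factors of
`V_ℓ E` at **every** finite place `v ∤ ℓ` rest on Kodaira–Néron alone.
[cite: SilvermanAEC2009, §C.16 (PDF p. 390)] [cite: SerreTate1968, §1 Lemma 2, §2 Thm. 3]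
[cite: SilvermanATAEC1994, Thm. IV.10.2(a) with Cor. IV.9.2(d) (PDF pp. 358, 340)] -/
theorem hasseWeilEulerFactor_geomPoints_of_isElliptic_of_kodairaNeron
    (hKN : ∀ v : HeightOneSpectrum (𝓞 K),
      (W.localMinimalModel v).kodairaNeron_exists_finset_reducesToNonsingular) :
    W.hasseWeilEulerFactor_geomPoints_of_isElliptic ℓ :=
  W.hasseWeilEulerFactor_geomPoints_of_isElliptic_of_codim_of_frobenius_torsion ℓ
    (W.codimFixed_inertia_rationalTate_eq_one_of_hasMultiplicativeReductionAt_of_kodairaNeron ℓ hKN)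
    (W.codimFixed_inertia_rationalTate_eq_two_of_hasAdditiveReductionAt_of_kodairaNeron ℓ hKN)
    (W.serreTate_frobenius_smul_torsion_of_hasSplitMultiplicativeReductionAt_of_kodairaNeron ℓ hKN)
    (W.serreTate_frobenius_smul_torsion_of_hasNonsplitMultiplicativeReductionAt_of_kodairaNeron ℓ
      hKN)

/-- Pointwise form for an elliptic `W`: the schema instance `hasseWeilEulerFactor_geomPoints W ℓ`
(consumed by `hasRationalEulerFactors_geomPoints_iff`, Knapp 11.67, lang.S28) from
Kodaira–Néron alone. [folklore] -/
theorem hasseWeilEulerFactor_geomPoints_of_kodairaNeron [W.IsElliptic]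
    (hKN : ∀ v : HeightOneSpectrum (𝓞 K),
      (W.localMinimalModel v).kodairaNeron_exists_finset_reducesToNonsingular) :
    W.hasseWeilEulerFactor_geomPoints ℓ :=
  W.hasseWeilEulerFactor_geomPoints_of_of_isElliptic ℓ
    (W.hasseWeilEulerFactor_geomPoints_of_isElliptic_of_kodairaNeron ℓ hKN)

end WeierstrassCurve

end
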